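import Literature.MathematicalPhysics.QuantumLattice.SectorPropagatorGram
import HarnessLib

/-!
# The sector decomposition of the single-scale propagator (BGM 2006, (2.45)–(2.49))

Topic `Literature/MathematicalPhysics/QuantumLattice`. Benfatto–Giuliani–Mastropietro 2006, §2.5:
the single-scale cutoff is decomposed into anisotropic sectors, `f_h(k) = Σ_{ω∈O_h} F_{h,ω}(k)`
(2.45)–(2.46) (`sum_anisotropicCutoff`), and accordingly the single-scale propagator is the sum
of the sector propagators, `g^{(h)}(x) = Σ_{ω∈O_h} g^{(h)}_ω(x)` ((2.48)–(2.49): the field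
`ψ^{(h)} = Σ_ω ψ^{(h)}_ω` is a sum of independent Grassmann fields with propagators `g^{(h)}_ω`).
PROVED here for the propagators of `SectorPropagatorSupBound` (continuum in `k₀`, central copy of
the shell):

* `singleScaleSymbol`, `singleScalePropagator` — the isotropic single-scale symbol `f_h(k) χ(k⃗)/D(k)` and
  propagator `g^{(h)}(x₀, x⃗)`;
* `integrable_sectorSymbol` — each sector symbol is integrable on `ℝ × ℝ²`;
* `sum_sectorSymbol` — `Σ_{ω<2^{n+1}} (F_{h,ω} χ/D) = f_h χ/D`;
* **`sum_sectorPropagator`** — `Σ_{ω<2^{n+1}} g^{(h)}_ω(x₀, x⃗) = g^{(h)}(x₀, x⃗)`.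

Everything is PROVED; the definitions are `singleScaleSymbol` and `singleScalePropagator`.

## Sources

* G. Benfatto, A. Giuliani, V. Mastropietro, Ann. Henri Poincaré 7 (2006) 809–898, §2.5
  (2.45)–(2.49) (arXiv:cond-mat/0507686 pp. 10–11). [BenfattoGiulianiMastropietro2006]
-/

noncomputable section

open Real Set MeasureTheory Complex Finset
open scoped ENNReal

namespace Literature.MathematicalPhysics.QuantumLattice

/-- **The isotropic single-scale symbol** `f_h(k) χ(k⃗) / (-ik₀ + ε(k⃗) - μ)`. [cite: BenfattoGiulianiMastropietro2006, §2.5 (2.45), (2.49)] -/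
def singleScaleSymbol (e₀ μ : ℝ) (n : ℕ) (p : ℝ × (Fin 2 → ℝ)) : ℂ :=
  ((scaleCutoffFn e₀ μ n p * zoneBump p.2 : ℝ) : ℂ) / sectorDenom μ p

/-- **The isotropic single-scale propagator** `g^{(h)}(x₀, x⃗) = ∫ e^{i(k⃗·x⃗ - k₀x₀)} f_h(k) χ(k⃗)/D(k) dk`.
[cite: BenfattoGiulianiMastropietro2006, §2.5 (2.48)–(2.49)] -/
def singleScalePropagator (e₀ μ : ℝ) (n : ℕ) (x₀ : ℝ) (x : Fin 2 → ℝ) : ℂ :=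
  ∫ p : ℝ × (Fin 2 → ℝ), sectorPlaneWave x₀ x p * singleScaleSymbol e₀ μ n p

/-- **The symbols add up**: `Σ_{ω<2^{n+1}} F_{h,ω} χ/D = f_h χ/D`. [cite: BenfattoGiulianiMastropietro2006, §2.5 (2.45)–(2.46)] -/
theorem sum_sectorSymbol (e₀ μ : ℝ) (n : ℕ) (p : ℝ × (Fin 2 → ℝ)) :
    ∑ ω ∈ range (sectorCount n), sectorSymbol e₀ μ n ω p = singleScaleSymbol e₀ μ n p := by
  simp only [sectorSymbol, singleScaleSymbol, div_eq_mul_inv, ← Finset.sum_mul]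
  congr 1
  rw [← sum_anisotropicCutoff e₀ μ n p]
  push_cast
  rw [Finset.sum_mul]

section Integrable

variable {μ : ℝ} (hμ₁ : -4 < μ) (hμ₂ : μ < -2 - Real.sqrt 2)
include hμ₁ hμ₂

/-- **Each sector symbol is integrable on `ℝ × ℝ²`** (bounded, measurable, supported in a box of
finite measure). [cite: BenfattoGiulianiMastropietro2006, §2.5 Lemma 2.2] -/
theorem integrable_sectorSymbol {e₀ : ℝ} (he : 0 < e₀) (he' : e₀ ≤ (4 + μ) / 2) (n : ℕ) (ω : ℤ) :
    Integrable (sectorSymbol e₀ μ n ω) := by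
  set θ₀ : ℝ := ((ω : ℝ) + 1 / 2) * sectorWidth n with hθ₀
  set a : ℝ := e₀ * (4 : ℝ) ^ (-(n : ℤ)) with ha
  set B₁ := normalExtent μ e₀ n with hB₁
  set B₂ := tangentExtent μ e₀ n with hB₂
  set M : ℝ := (e₀ * (4 : ℝ) ^ (-(n : ℤ) - 2))⁻¹ with hM
  set T : Set (ℝ × (Fin 2 → ℝ)) := Icc (-a) a ×ˢ sectorBox μ θ₀ B₁ B₂ with hT
  have hfT : ∀ p, p ∉ T → sectorSymbol e₀ μ n ω p = 0 := by
    intro p hp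
    by_contra hne
    obtain ⟨h1, h2⟩ := sectorSymbol_ne_zero hμ₁ hμ₂ he he' hne
    exact hp (mk_mem_prod h1 h2)
  have hvol : volume T ≤ ENNReal.ofReal (2 * a) * (ENNReal.ofReal (2 * B₁) * ENNReal.ofReal (2 * B₂)) := by
    rw [hT, MeasureTheory.Measure.volume_eq_prod, Measure.prod_prod, Real.volume_Icc, show a - -a = 2 * a by ring]
    gcongr
    exact volume_sectorBox_le hμ₁ hμ₂ θ₀ B₁ B₂
  have hvolT : volume T < ⊤ := lt_of_le_of_lt hvol (by
    refine ENNReal.mul_lt_top ENNReal.ofReal_lt_top (ENNReal.mul_lt_top ENNReal.ofReal_lt_top ENNReal.ofReal_lt_top))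
  have hfm : AEStronglyMeasurable (sectorSymbol e₀ μ n ω) volume := by
    refine Measurable.aestronglyMeasurable ?_
    unfold sectorSymbol
    exact (Complex.measurable_ofReal.comp (continuous_sectorNumer he he' n ω).measurable).div
      continuous_sectorDenom'.measurable
  have hnc : Continuous (normalCoord μ θ₀) := by unfold normalCoord; fun_prop
  have htc : Continuous (tangentCoord μ θ₀) := by unfold tangentCoord; fun_prop
  have hBox : IsClosed (sectorBox μ θ₀ B₁ B₂) :=
    (isClosed_le (continuous_abs.comp hnc) continuous_const).inter (isClosed_le (continuous_abs.comp htc) continuous_const)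
  have hTm : MeasurableSet T := measurableSet_Icc.prod hBox.measurableSet
  have hfind : sectorSymbol e₀ μ n ω = T.indicator (sectorSymbol e₀ μ n ω) := by
    funext p
    by_cases hp : p ∈ T
    · rw [indicator_of_mem hp]
    · rw [indicator_of_notMem hp, hfT p hp]
  rw [hfind, integrable_indicator_iff hTm]
  exact Measure.integrableOn_of_bounded (M := M) hvolT.ne hfm (ae_of_all _ fun p => norm_sectorSymbol_le he n ω p)

/-- The sector integrand `e^{iφ} F_{h,ω}χ/D` is integrable. [folklore] -/
theorem integrable_sectorPlaneWave_mul_sectorSymbol {e₀ : ℝ} (he : 0 < e₀) (he' : e₀ ≤ (4 + μ) / 2) (n : ℕ) (ω : ℤ)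
    (x₀ : ℝ) (x : Fin 2 → ℝ) :
    Integrable fun p => sectorPlaneWave x₀ x p * sectorSymbol e₀ μ n ω p := by
  refine (integrable_sectorSymbol hμ₁ hμ₂ he he' n ω).bdd_mul (c := 1)
    (continuous_sectorPlaneWave x₀ x).aestronglyMeasurable (ae_of_all _ fun p => ?_)
  rw [norm_sectorPlaneWave]

/-- **The sector decomposition of the single-scale propagator**:
`Σ_{ω<2^{n+1}} g^{(h)}_ω(x₀, x⃗) = g^{(h)}(x₀, x⃗)`. [cite: BenfattoGiulianiMastropietro2006, §2.5 (2.48)–(2.49)] -/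
theorem sum_sectorPropagator {e₀ : ℝ} (he : 0 < e₀) (he' : e₀ ≤ (4 + μ) / 2) (n : ℕ) (x₀ : ℝ) (x : Fin 2 → ℝ) :
    ∑ ω ∈ range (sectorCount n), sectorPropagator e₀ μ n ω x₀ x = singleScalePropagator e₀ μ n x₀ x := by
  have h : ∀ ω ∈ range (sectorCount n),
      Integrable (fun p => sectorPlaneWave x₀ x p * sectorSymbol e₀ μ n (ω : ℕ) p) volume :=
    fun ω _ => integrable_sectorPlaneWave_mul_sectorSymbol hμ₁ hμ₂ he he' n ω x₀ x
  rw [singleScalePropagator, show (∑ ω ∈ range (sectorCount n), sectorPropagator e₀ μ n ω x₀ x) =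
      ∑ ω ∈ range (sectorCount n), ∫ p, sectorPlaneWave x₀ x p * sectorSymbol e₀ μ n (ω : ℕ) p from rfl,
    ← integral_finsetSum _ h]
  refine integral_congr_ae (ae_of_all _ fun p => ?_)
  simp only
  rw [← Finset.mul_sum, ← sum_sectorSymbol]

/-- **`|g^{(h)}(x)| ≤ C γ^h`**: the single-scale propagator of a two-dimensional system with an
extended Fermi curve is `O(γ^h)` (sum over the `2^{n+1}` sectors of the sector bounds
`|g^{(h)}_ω| ≤ C 4^{-n}2^{-n}`). [cite: BenfattoGiulianiMastropietro2006, §2.5 (2.48)–(2.52)] -/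
theorem exists_norm_singleScalePropagator_le {e₀ : ℝ} (he : 0 < e₀) (he' : e₀ ≤ (4 + μ) / 2) :
    ∃ C : ℝ, 0 ≤ C ∧ ∀ (n : ℕ) (x₀ : ℝ) (x : Fin 2 → ℝ),
      ‖singleScalePropagator e₀ μ n x₀ x‖ ≤ C * (4 : ℝ) ^ (-(n : ℤ)) := by
  obtain ⟨C, hC0, hC⟩ := exists_norm_sectorPropagator_le hμ₁ hμ₂ he he'
  refine ⟨2 * C, by positivity, fun n x₀ x => ?_⟩
  rw [← sum_sectorPropagator hμ₁ hμ₂ he he' n x₀ x]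
  have hcard : ((range (sectorCount n)).card : ℝ) = 2 ^ (n + 1) := by
    rw [Finset.card_range, sectorCount]; norm_num
  have h22 : (2 : ℝ) ^ (n + 1) * (2 : ℝ) ^ (-(n : ℤ)) = 2 := by
    rw [zpow_neg, zpow_natCast, pow_succ]; field_simp
  calc ‖∑ ω ∈ range (sectorCount n), sectorPropagator e₀ μ n ω x₀ x‖
      ≤ ∑ ω ∈ range (sectorCount n), ‖sectorPropagator e₀ μ n ω x₀ x‖ := norm_sum_le _ _
    _ ≤ ∑ _ω ∈ range (sectorCount n), C * ((4 : ℝ) ^ (-(n : ℤ)) * (2 : ℝ) ^ (-(n : ℤ))) :=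
        Finset.sum_le_sum fun ω _ => hC n ω x₀ x
    _ = 2 ^ (n + 1) * (C * ((4 : ℝ) ^ (-(n : ℤ)) * (2 : ℝ) ^ (-(n : ℤ)))) := by
        rw [Finset.sum_const, nsmul_eq_mul, hcard]
    _ = 2 * C * (4 : ℝ) ^ (-(n : ℤ)) := by
        linear_combination (C * (4 : ℝ) ^ (-(n : ℤ))) * h22

end Integrable

end Literature.MathematicalPhysics.QuantumLattice

end
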